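import Summits.SmoothPoincare4.SmoothPoincare4.Theses.EntropyRung

/-!
# Route EntropyRung — the assembly item

`Assembly` (item stmt-SmoothPoincare4-6812) is the implication
`SubcylindricalRecognition → SubcylindricalExistence → SmoothPoincare4`, i.e. literally the type of
the route's deciding theorem `Summit.SmoothPoincare4.SmoothPoincare4.Theses.EntropyRung.closes`
(planner-authored, proved in the route file, axioms `propext`/`Classical.choice`/`Quot.sound`):
for `M` with the summit binders and `e : M ≃ₕ S⁴`, compactness comes from the proved tree theorem
`Literature.Topology.FourManifolds.compactSpace_of_homotopyEquiv_sphere_four_holds`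
(Hatcher, *Algebraic Topology*, Prop. 3.29), `T3Space` from compact + Hausdorff, the Borel σ-algebra
discharges the measurable-space binders, `SubcylindricalExistence` supplies the metric and
`SubcylindricalRecognition` the diffeomorphism. No named fact is a hypothesis.
-/

-- the registered namespace `Summit.SmoothPoincare4.SmoothPoincare4.Theorems` repeats a component
set_option linter.dupNamespace false

namespace Summit.SmoothPoincare4.SmoothPoincare4.Theorems

open Summit.SmoothPoincare4.SmoothPoincare4.Theses.EntropyRung

/-- **Assembly of route EntropyRung** (settles item stmt-SmoothPoincare4-6812):
`SubcylindricalRecognition → SubcylindricalExistence → SmoothPoincare4`.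
It is the route's proved deciding theorem `EntropyRung.closes`, repackaged as the `Prop`
`EntropyRung.Assembly`: unfold and apply `closes` to the two hypotheses. [folklore] -/
theorem entropyRung_assembly_proof :
    Summit.SmoothPoincare4.SmoothPoincare4.Theses.EntropyRung.Assembly := by
  unfold Summit.SmoothPoincare4.SmoothPoincare4.Theses.EntropyRung.Assembly
  intro hRung hEnt
  exact Summit.SmoothPoincare4.SmoothPoincare4.Theses.EntropyRung.closes hRung hEnt

end Summit.SmoothPoincare4.SmoothPoincare4.Theorems
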